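/-
Copyright: the b2b-balaban T⁴-continuum CRUX team, row NE7b OWNER lineage `t4-ne7b-p1` (gen 123). Project licence.
-/
import Summits.QuantumFields.BalabanUV.T4Continuum.Spine.NE7b.SupZdCoarseOperator
import Summits.QuantumFields.BalabanUV.T4Continuum.Spine.NE7b.SupZdPropagatorProfile

/-!
# EXPONENTIAL SUMS ON `ℤ^d` FROM THE TORUS, AND THE ROWS OF THE INFINITE-VOLUME COARSE OPERATOR: `Σ_{b′ ∈ S} e^{−δ|b − b′|₁} ≤ K_δ =
# (2∕(1 − e^{−δ}))^d` for EVERY finite `S ⊂ ℤ^d` (embed `S` in a large torus, where `ρ ≤ |·|₁` and (132) bounds the full torus sum), hence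
# `b′ ↦ e^{−δ|b − b′|₁}` is summable on `ℤ^d` with `Σ′ ≤ K_δ`; consequently the rows of `T_∞` ((186): `|T_∞(b,b′)| ≤ C·e^{−δ|b − b′|₁}`) act on
# bounded coarse functions: `|Σ_{b′ ∈ S} T_∞(b,b′)g(b′)| ≤ C·K_δ·‖g‖_∞` uniformly in `S`, the series `Σ′_{b′} T_∞(b,b′)g(b′)` converges absolutely,
# and `|Σ′| ≤ C·K_δ·‖g‖_∞` — `T_∞` is a bounded operator on `ℓ^∞(ℤ^d)` entrywise (row NE7b, node U5c; (132)∕(180)∕(186) BY NAME; [folklore])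

Cell `pub-balaban`, sub-cell `t4`, spine estimate NE7b (`T4WeightBudget.RelWeightBound`; the cell's OWN estimate — NOT PRINTED in
[Bałaban 1983–89], NOT PROVED).  Crux-route work under `Spine/NE7b/` by the row OWNER (`t4-ne7b-p1` gen 123, file (189)) under FREEZE
(0)'s crux-prover clause; NOTHING of Bałaban's is named as a Lean object, valued or asserted; no `T4Continuum/Support` leaf typed; no `def`,
no notation; zero `sorry`.  Imports (BY NAME): the OWNER's (186) `…SupZdCoarseOperator` (`zd_coarse_entry_decay`; through it (182)∕(180)
`inWindow_of_le`, (132) `torus_sum_exp_le`, the window kit), (182) `…SupZdPropagatorProfile` (`torusDist_le_l1`), Mathlib's `summable_of_sum_le`,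
`Real.tsum_le_of_sum_le`, `Summable.of_norm_bounded`.

WHY (located).  Every operator statement on `ℤ^d` (Schur tests for `T_∞`, its inverse, the response and covariance in infinite volume)
needs the geometric sum `Σ_{b′ ∈ ℤ^d} e^{−δ|b − b′|₁} < ∞` with an explicit bound.  The torus column has it ((132) `torus_sum_exp_le`, by a
product formula on `(ℤ∕s)^d`); on `ℤ^d` no new computation is needed: a finite `S` lies inside the centred window of a large coarse torus
`Site d (3^k)`, on which `σ` is injective and `ρ_{3^k}(σ b, σ b′) ≤ |b − b′|₁` ((182) `torusDist_le_l1`), so the finite sum is dominated by the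
full torus sum.  Bounded partial sums of a nonnegative family give summability and the `tsum` bound (`Real.tsum_le_of_sum_le`).

WHAT IS PROVED ([folklore]; `X d = ℤ^d`, `|b|₁ = Σ_i|b i|`, `K_δ = (2∕(1 − e^{−δ}))^d`):
* §1 `finset_sum_exp_l1_le_of_window`, **`finset_sum_exp_l1_le`** (`δ > 0`, every `b`, every finite `S`: `Σ_{b′ ∈ S} e^{−δ|b − b′|₁} ≤ K_δ`), **`summable_exp_l1`**,
  **`tsum_exp_l1_le`** (`Σ′_{b′ ∈ ℤ^d} e^{−δ|b − b′|₁} ≤ K_δ`).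
* §2 `finset_sum_kernel_le` (`|T(b,b′)| ≤ C·e^{−δ|b − b′|₁}`, `|g| ≤ M` ⟹ `|Σ_{b′ ∈ S} T(b,b′)g b′| ≤ C·K_δ·M` for every finite `S`),
  `summable_kernel_row`, `tsum_kernel_row_le` (the series converges absolutely and `|Σ′_{b′} T(b,b′)g b′| ≤ C·K_δ·M`).
* §3 **`zd_coarse_row_le`** (`d ≥ 3`, class hypotheses, `V : ℤ^d → [−λ, Λ]`, ANY bounded block columns `Ψ`, `|g| ≤ M`: for every finite `S`,
  `|Σ_{b′ ∈ S}((n+1)^{−d}Σ_{q ∈ B n b}Ψ_{b′} q)·g b′| ≤ C·M`, and the full series is summable with `|Σ′| ≤ C·M`, `C` from `(d, a, λ, Λ)` only).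
* §4 toy (`d = 3`).

HONEST (what this is NOT).  Row bounds only (`T_∞` on `ℓ^∞`); the inverse of `T_∞` is the sequel; `d ≥ 3` for §3 only; scalar skeleton
((A3), NC-NE7b-α UNRULED); nothing of the covariant propagators of [B4]–[B6]; nothing of Bałaban's.  BY-NAME EFFECT ON THE WALL: NONE.  NE7b
NOT PRINTED ∕ NOT PROVED; spine PROVED 0∕9; rung (B)+1 — the programme's measures remain FINITE-torus statements; NOT the mass gap, NOT Clay.
HONEST DEPENDENCY: continuum YM on T⁴ ⇐ BetaPertH ∧ nine spine estimates (0∕9 proved); BetaPertH ⇐ (D1) ∧ (D4) ∧ CAP+tail; G-an2-4 gates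
asym, D1 and NE2∕3∕4.
-/

set_option autoImplicit false

noncomputable section

namespace Summit.QuantumFields.BalabanUV.T4Continuum.NE7b.SupZdExponentialSums

open Real Filter Topology
open Literature.MathematicalPhysics.QuantumFieldTheory.Balaban1983to89
open B6QGQLower276 (X e blk B side chart mem_B sum_B sum_B_const card_cube blk_chart)
open Beta (Site siteOf windowMap siteOf_windowMap windowMap_siteOf)
open SupTorusBlockDistance (torus_sum_exp_le)
open SupZdPropagatorLimit (inWindow_of_le)
open SupZdPropagatorProfile (torusDist_le_l1)
open SupZdCoarseOperator (zd_coarse_entry_decay sum_window_reading)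

variable {d : ℕ}

/-! ## §1. `Σ_{b′} e^{−δ|b − b′|₁}` on `ℤ^d`: finite sums, summability, the `tsum` bound -/

/-- The torus embedding behind `finset_sum_exp_l1_le`: for a coarse period `N` whose centred window contains `S` (`wm_N(σ_N b′) = b′` on `S`),
`Σ_{b′ ∈ S} e^{−δ|b − b′|₁} ≤ Σ_{y′ ∈ Site d N} e^{−δρ_N(σ b, y′)} ≤ K_δ`. [folklore] -/
theorem finset_sum_exp_l1_le_of_window {δ : ℝ} (hδ : 0 < δ) (N : ℕ) [NeZero N] (b : X d) (S : Finset (X d))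
    (hS : ∀ b' ∈ S, windowMap d N (siteOf d N b') = b') :
    ∑ b' ∈ S, exp (-(δ * ∑ i, (((b i - b' i).natAbs : ℕ) : ℝ))) ≤ (2 * (1 - exp (-δ))⁻¹) ^ d := by
  classical
  have h1 : ∑ b' ∈ S, exp (-(δ * ∑ i, (((b i - b' i).natAbs : ℕ) : ℝ)))
      ≤ ∑ b' ∈ S, exp (-(δ * ∑ i, ((((siteOf d N b) i - (siteOf d N b') i).valMinAbs.natAbs : ℕ) : ℝ))) := by
    refine Finset.sum_le_sum fun b' _ => exp_le_exp.2 ?_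
    have := mul_le_mul_of_nonneg_left (torusDist_le_l1 (d := d) N b b') hδ.le
    linarith
  -- `Σ_{b′ ∈ S} G(σ b′) ≤ Σ_{y′} G y′` through (186) `sum_window_reading` with `F = 𝟙_S·(G∘σ)`
  have h23 : ∑ b' ∈ S, exp (-(δ * ∑ i, ((((siteOf d N b) i - (siteOf d N b') i).valMinAbs.natAbs : ℕ) : ℝ)))
      ≤ ∑ y' : Site d N, exp (-(δ * ∑ i, ((((siteOf d N b) i - y' i).valMinAbs.natAbs : ℕ) : ℝ))) := by
    have hF := sum_window_reading N S hS
      (fun c => if c ∈ S then exp (-(δ * ∑ i, ((((siteOf d N b) i - (siteOf d N c) i).valMinAbs.natAbs : ℕ) : ℝ))) else 0)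
      (fun c hc => by rw [if_neg hc])
    have e1 : ∑ b' ∈ S, exp (-(δ * ∑ i, ((((siteOf d N b) i - (siteOf d N b') i).valMinAbs.natAbs : ℕ) : ℝ)))
        = ∑ b' ∈ S, (if b' ∈ S then exp (-(δ * ∑ i, ((((siteOf d N b) i - (siteOf d N b') i).valMinAbs.natAbs : ℕ) : ℝ))) else 0) :=
      Finset.sum_congr rfl fun b' hb' => by rw [if_pos hb']
    rw [e1, ← hF]
    refine Finset.sum_le_sum fun y' _ => ?_
    split_ifs with hy
    · rw [siteOf_windowMap]
    · exact (exp_pos _).le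
  have h4 : ∑ y' : Site d N, exp (-(δ * ∑ i, ((((siteOf d N b) i - y' i).valMinAbs.natAbs : ℕ) : ℝ)))
      ≤ (2 * (1 - exp (-δ))⁻¹) ^ d := torus_sum_exp_le (d := d) N hδ _
  exact h1.trans (h23.trans h4)

/-- **`Σ_{b′ ∈ S} e^{−δ|b − b′|₁} ≤ (2∕(1 − e^{−δ}))^d` FOR EVERY FINITE `S ⊂ ℤ^d`** (`δ > 0`): embed `S` in the centred window of a large coarse
torus (`3^k` with `k` beyond the window radius of `S`), where `σ` is injective on `S`, `ρ(σ b, σ b′) ≤ |b − b′|₁`, and (132) `torus_sum_exp_le`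
bounds the full torus sum. [folklore] -/
theorem finset_sum_exp_l1_le {δ : ℝ} (hδ : 0 < δ) (b : X d) (S : Finset (X d)) :
    ∑ b' ∈ S, exp (-(δ * ∑ i, (((b i - b' i).natAbs : ℕ) : ℝ))) ≤ (2 * (1 - exp (-δ))⁻¹) ^ d := by
  classical
  obtain ⟨k, hk⟩ : ∃ k : ℕ, 2 * ∑ b' ∈ S, ∑ i, (b' i).natAbs + 1 ≤ k := ⟨_, le_rfl⟩
  refine finset_sum_exp_l1_le_of_window hδ (3 ^ k) b S fun b' hb' => windowMap_siteOf d (3 ^ k) fun i => ?_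
  have hle : ∑ i, (b' i).natAbs ≤ ∑ b' ∈ S, ∑ i, (b' i).natAbs :=
    Finset.single_le_sum (f := fun b' => ∑ i, (b' i).natAbs) (fun _ _ => Nat.zero_le _) hb'
  have h := inWindow_of_le 0 k b' (by omega) i
  simpa using h

/-- **`b′ ↦ e^{−δ|b − b′|₁}` IS SUMMABLE ON `ℤ^d`** (nonnegative with bounded partial sums). [folklore] -/
theorem summable_exp_l1 {δ : ℝ} (hδ : 0 < δ) (b : X d) :
    Summable fun b' : X d => exp (-(δ * ∑ i, (((b i - b' i).natAbs : ℕ) : ℝ))) :=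
  summable_of_sum_le (fun _ => (exp_pos _).le) (finset_sum_exp_l1_le hδ b)

/-- **`Σ′_{b′ ∈ ℤ^d} e^{−δ|b − b′|₁} ≤ (2∕(1 − e^{−δ}))^d`.** [folklore] -/
theorem tsum_exp_l1_le {δ : ℝ} (hδ : 0 < δ) (b : X d) :
    ∑' b' : X d, exp (-(δ * ∑ i, (((b i - b' i).natAbs : ℕ) : ℝ))) ≤ (2 * (1 - exp (-δ))⁻¹) ^ d :=
  Real.tsum_le_of_sum_le (fun _ => (exp_pos _).le) (finset_sum_exp_l1_le hδ b)

/-! ## §2. Exponentially decaying kernels act on bounded functions -/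

section Kernel

variable {δ C M : ℝ} (hδ : 0 < δ) (T : X d → X d → ℝ) (hT : ∀ b b', |T b b'| ≤ C * exp (-(δ * ∑ i, (((b i - b' i).natAbs : ℕ) : ℝ))))
  (g : X d → ℝ) (hg : ∀ b', |g b'| ≤ M)

include hδ hT hg in
/-- **A DECAYING KERNEL ON A BOUNDED FUNCTION, FINITE SUMS**: `|T(b,b′)| ≤ C·e^{−δ|b − b′|₁}`, `|g| ≤ M` ⟹ for every finite `S`,
`|Σ_{b′ ∈ S} T(b,b′)g b′| ≤ C·K_δ·M`. [folklore] -/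
theorem finset_sum_kernel_le (b : X d) (S : Finset (X d)) : |∑ b' ∈ S, T b b' * g b'| ≤ C * (2 * (1 - exp (-δ))⁻¹) ^ d * M := by
  have hM : 0 ≤ M := (abs_nonneg _).trans (hg b)
  have hC : 0 ≤ C := by
    have h := (abs_nonneg _).trans (hT b b)
    exact le_of_mul_le_mul_right (by rw [zero_mul]; exact h) (exp_pos _)
  calc |∑ b' ∈ S, T b b' * g b'| ≤ ∑ b' ∈ S, |T b b' * g b'| := Finset.abs_sum_le_sum_abs _ _
    _ ≤ ∑ b' ∈ S, C * exp (-(δ * ∑ i, (((b i - b' i).natAbs : ℕ) : ℝ))) * M :=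
        Finset.sum_le_sum fun b' _ => by rw [abs_mul]; exact mul_le_mul (hT b b') (hg b') (abs_nonneg _) (by positivity)
    _ = C * M * ∑ b' ∈ S, exp (-(δ * ∑ i, (((b i - b' i).natAbs : ℕ) : ℝ))) := by rw [Finset.mul_sum]; exact Finset.sum_congr rfl fun _ _ => by ring
    _ ≤ C * M * (2 * (1 - exp (-δ))⁻¹) ^ d := mul_le_mul_of_nonneg_left (finset_sum_exp_l1_le hδ b S) (by positivity)
    _ = _ := by ring

include hδ hT hg in
/-- The row series `Σ′_{b′} T(b,b′)g b′` converges absolutely. [folklore] -/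
theorem summable_kernel_row (b : X d) : Summable fun b' : X d => T b b' * g b' := by
  have hM : 0 ≤ M := (abs_nonneg _).trans (hg b)
  refine Summable.of_norm_bounded (g := fun b' : X d => C * M * exp (-(δ * ∑ i, (((b i - b' i).natAbs : ℕ) : ℝ))))
    ((summable_exp_l1 hδ b).mul_left (C * M)) fun b' => ?_
  rw [Real.norm_eq_abs, abs_mul]
  calc |T b b'| * |g b'| ≤ C * exp (-(δ * ∑ i, (((b i - b' i).natAbs : ℕ) : ℝ))) * M := mul_le_mul (hT b b') (hg b') (abs_nonneg _)
        (le_trans (abs_nonneg _) (hT b b'))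
    _ = _ := by ring

include hδ hT hg in
/-- **A DECAYING KERNEL ON A BOUNDED FUNCTION, THE SERIES**: `|Σ′_{b′} T(b,b′)g b′| ≤ C·K_δ·M`. [folklore] -/
theorem tsum_kernel_row_le (b : X d) : |∑' b' : X d, T b b' * g b'| ≤ C * (2 * (1 - exp (-δ))⁻¹) ^ d * M := by
  classical
  have hsum := summable_kernel_row hδ T hT g hg b
  have hlim : Tendsto (fun S : Finset (X d) => ∑ b' ∈ S, T b b' * g b') atTop (𝓝 (∑' b' : X d, T b b' * g b')) := hsum.hasSum
  have hle : ∀ S : Finset (X d), |∑ b' ∈ S, T b b' * g b'| ≤ C * (2 * (1 - exp (-δ))⁻¹) ^ d * M :=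
    fun S => finset_sum_kernel_le hδ T hT g hg b S
  exact le_of_tendsto hlim.abs (Filter.Eventually.of_forall hle)

end Kernel

/-! ## §3. THE END: the rows of the infinite-volume coarse operator -/

/-- **HEADLINE — THE ROWS OF `T_∞` ACT ON `ℓ^∞(ℤ^d)`**: `d ≥ 3`, `a > 0`, `λ < min(2,a)`, `Λ ≥ 0` ⟹ `∃ C > 0` (from `(d, a, λ, Λ)` only): for ALL
`n`, `V : ℤ^d → [−λ, Λ]`, ANY bounded block columns `Ψ_{b′}` of `H_V` and every coarse `|g| ≤ M`: for every finite `S`,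
`|Σ_{b′ ∈ S}((n+1)^{−d}Σ_{q ∈ B n b}Ψ_{b′} q)·g b′| ≤ C·M`, the series over `ℤ^d` converges absolutely, and `|Σ′_{b′}(…)·g b′| ≤ C·M` — (186)'s entry
decay and §2. [folklore] -/
theorem zd_coarse_row_le (hd : 3 ≤ d) (a : ℝ) (ha : 0 < a) {lam Lam : ℝ} (hlam : lam < min 2 a) (hLam : 0 ≤ Lam) :
    ∃ C : ℝ, 0 < C ∧ ∀ (n : ℕ) (V : X d → ℝ), (∀ p, -lam ≤ V p) → (∀ p, V p ≤ Lam) →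
      ∀ (Ψ : X d → X d → ℝ) (BΨ : X d → ℝ), (∀ b' p, |Ψ b' p| ≤ BΨ b') →
      (∀ b' p, ((n : ℝ) + 1) ^ 2 * ∑ μ, (2 * Ψ b' p - Ψ b' (p + e μ) - Ψ b' (p - e μ))
        + a / ((n : ℝ) + 1) ^ d * ∑ q ∈ B n (blk n p), Ψ b' q + V p * Ψ b' p = if blk n p = b' then 1 else 0) →
      ∀ (g : X d → ℝ) (M : ℝ), (∀ b', |g b'| ≤ M) → ∀ b : X d,
        (∀ S : Finset (X d), |∑ b' ∈ S, ((((n : ℝ) + 1) ^ d)⁻¹ * ∑ q ∈ B n b, Ψ b' q) * g b'| ≤ C * M) ∧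
        Summable (fun b' : X d => ((((n : ℝ) + 1) ^ d)⁻¹ * ∑ q ∈ B n b, Ψ b' q) * g b') ∧
        |∑' b' : X d, ((((n : ℝ) + 1) ^ d)⁻¹ * ∑ q ∈ B n b, Ψ b' q) * g b'| ≤ C * M := by
  obtain ⟨C, δ, hC, hδ, H186⟩ := zd_coarse_entry_decay (d := d) hd a ha hlam hLam
  have hK : 0 < (2 * (1 - exp (-δ))⁻¹) ^ d := pow_pos (mul_pos two_pos (inv_pos.2 (sub_pos.2 (exp_lt_one_iff.2 (by linarith))))) d
  refine ⟨C * (2 * (1 - exp (-δ))⁻¹) ^ d, by positivity, ?_⟩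
  intro n V hV hV' Ψ BΨ hΨB hΨ g M hg b
  have hT : ∀ b b' : X d, |(((n : ℝ) + 1) ^ d)⁻¹ * ∑ q ∈ B n b, Ψ b' q| ≤ C * exp (-(δ * ∑ i, (((b i - b' i).natAbs : ℕ) : ℝ))) :=
    fun b b' => H186 n V hV hV' Ψ BΨ hΨB hΨ b b'
  exact ⟨fun S => finset_sum_kernel_le hδ (fun b b' => (((n : ℝ) + 1) ^ d)⁻¹ * ∑ q ∈ B n b, Ψ b' q) hT g hg b S,
    summable_kernel_row hδ (fun b b' => (((n : ℝ) + 1) ^ d)⁻¹ * ∑ q ∈ B n b, Ψ b' q) hT g hg b,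
    tsum_kernel_row_le hδ (fun b b' => (((n : ℝ) + 1) ^ d)⁻¹ * ∑ q ∈ B n b, Ψ b' q) hT g hg b⟩

/-! ## §4. Toy -/

/-- Toy (`d = 3`, `δ = 1`): the geometric series around the origin of `ℤ³` is summable. -/
example : Summable fun b' : X 3 => exp (-(1 * ∑ i, ((((0 : X 3) i - b' i).natAbs : ℕ) : ℝ))) := summable_exp_l1 (d := 3) one_pos 0

end Summit.QuantumFields.BalabanUV.T4Continuum.NE7b.SupZdExponentialSums
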